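import Summits.AtomisticToContinuum.HydrodynamicLimit.Theorems.CollisionIsometryCLTAdaptedWeightCLTSustainedAnisotropy
import Summits.AtomisticToContinuum.HydrodynamicLimit.Theorems.JParityClosureOddContactSymmetryGibbsInvariance
import Literature.MathematicalPhysics.KineticTheory.HardSphereTwoTimePressure

/-!
# Line `sustained-anisotropy-superexp`, stub `stub_superExp` (lead), file 1: uniformity in the window end is free

Crux `CollisionIsometryCLT.AdaptedWeightCLT` (stmt-AtomisticToContinuum-14868, rev-12 TIME-LOCAL form), route `CollisionIsometryCLT`,
sub-problem `HydrodynamicLimit`; line lead `prover-line-stmt-AtomisticToContinuum-14868-a1-0`; `--supports` helper toward the registered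
stub `stub_superExp` (the equilibrium super-exponential rarity of window-sustained cell anisotropy).

The registered stub asks its bound `G_N(susEvent(t')) ≤ e^{-c(N+1)}` for ALL window ends `t' ≥ Δ_N`, under the HOMOGENEOUS Gibbs law
`G_N = localGibbsLaw σ 1 0 θe N Φ`. This file proves that the uniformity in `t'` costs nothing:

* `susEvent_shift` — on the good set of the flow, the sustained-anisotropy event with window `[t' − Δ, t']` is the preimage under
  `Φ_{t'−Δ}` of the event with window `[0, Δ]` (group property of the flow + translation invariance of Lebesgue measure in the window
  variable; the three clauses `winA`, `iprF ∘ Φ_{t'−Δ}`, `winTail` shift alike);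
* `gibbs_susEvent_le` — hence `G_N(susEvent(t')) ≤ G_N(susEvent(Δ))` for every `t' ≥ Δ ≥ 0` (the good set is `G_N`-conull and every
  flow map preserves `G_N`: `measurePreserving_flow_localGibbsLaw_const`, stmt-9239 `GibbsInvariance`), and the `∀ t' ≥ Δ_N` clause of
  `stub_superExp` follows from its instance `t' = Δ_N` (`forall_windowEnd_of_windowStart`).

No dynamics beyond the `HardSphereFlow` axioms (`flow_add`, `flow_zero`, `mapsTo_good`) is used.
-/

namespace Summit.AtomisticToContinuum.HydrodynamicLimit.Theorems.SustainedAnisotropy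

open scoped BigOperators Topology Classical MeasureTheory ENNReal InnerProductSpace
open Filter Set MeasureTheory
open Literature.Analysis.FluidPDE
open Summit.AtomisticToContinuum.HydrodynamicLimit.Theorems.ContactSourceDuhamel
open Summit.AtomisticToContinuum.HydrodynamicLimit.Theorems.ContactSourceDuhamel.TimeLocal
open Summit.AtomisticToContinuum.HydrodynamicLimit.Theorems.ContactBalance
open Literature.MathematicalPhysics.KineticTheory (hsDiameter localGibbsLaw empiricalDensityField
  empiricalMomentumField ae_mem_good_localGibbsLaw)

noncomputable section

namespace SuperExp

variable {σ : ℝ} {N : ℕ}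

/-- Translation of the window: `∫_{u ∈ [a, b]} g(u + c) du = ∫_{v ∈ [a + c, b + c]} g(v) dv` (Lebesgue measure is translation
invariant; no integrability needed — both sides are the same Bochner integral after the measure-preserving change of variables). -/
theorem setIntegral_Icc_comp_add_right (g : ℝ → ℝ) (a b c : ℝ) :
    ∫ u in Icc a b, g (u + c) = ∫ v in Icc (a + c) (b + c), g v := by
  have h := (measurePreserving_add_right (volume : Measure ℝ) c).setIntegral_preimage_emb
    (measurableEmbedding_addRight c) g (Icc (a + c) (b + c))
  rw [Set.preimage_add_const_Icc, add_sub_cancel_right, add_sub_cancel_right] at h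
  exact h

/-- Along a good orbit, the flow restarted at `Φ_s z` is the flow from `z` shifted by `s`. -/
theorem flow_flow_of_mem_good (Φ : Flow σ N) {z : Cfg N} (hz : z ∈ Φ.good) (u s : ℝ) :
    Φ.flow u (Φ.flow s z) = Φ.flow (u + s) z :=
  (Φ.flow_add u s z hz).symm

/-- The window-averaged cell anisotropy shifts with the flow: `winA(Δ; Δ)(Φ_s z) = winA(Δ; Δ + s)(z)` on the good set. -/
theorem winA_flow (Φ : Flow σ N) (φ ψ : ℕ → T3 → ℝ) (Δ s : ℝ) {z : Cfg N} (hz : z ∈ Φ.good) :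
    winA σ N Φ φ ψ Δ Δ (Φ.flow s z) = winA σ N Φ φ ψ Δ (Δ + s) z := by
  unfold winA
  congr 1
  have h1 : (fun u => ∫ x, cellA N φ ψ (Φ.flow u (Φ.flow s z)) x) =
      fun u => (fun v => ∫ x, cellA N φ ψ (Φ.flow v z) x) (u + s) := by
    funext u
    simp only [flow_flow_of_mem_good Φ hz]
  rw [h1, setIntegral_Icc_comp_add_right (fun v => ∫ x, cellA N φ ψ (Φ.flow v z) x) (Δ - Δ) Δ s]
  congr 1
  rw [sub_self, zero_add, add_sub_cancel_left]

/-- The window-local exponential moment shifts with the flow in the same way. -/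
theorem winTail_flow (Φ : Flow σ N) (lam Δ s : ℝ) {z : Cfg N} (hz : z ∈ Φ.good) :
    winTail σ N Φ lam Δ Δ (Φ.flow s z) = winTail σ N Φ lam Δ (Δ + s) z := by
  unfold winTail
  congr 1
  have h1 : (fun u => ∫ y, Real.exp (lam * ‖y.2‖ ^ 2) ∂(empiricalMeasure (Φ.flow u (Φ.flow s z)))) =
      fun u => (fun v => ∫ y, Real.exp (lam * ‖y.2‖ ^ 2) ∂(empiricalMeasure (Φ.flow v z))) (u + s) := by
    funext u
    simp only [flow_flow_of_mem_good Φ hz]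
  rw [h1, setIntegral_Icc_comp_add_right
    (fun v => ∫ y, Real.exp (lam * ‖y.2‖ ^ 2) ∂(empiricalMeasure (Φ.flow v z))) (Δ - Δ) Δ s]
  congr 1
  rw [sub_self, zero_add, add_sub_cancel_left]

/-- **The sustained-anisotropy event shifts with the flow.** For a good datum `z` and `s = t' − Δ`:
`z ∈ susEvent(t')` iff `Φ_s z ∈ susEvent(Δ)`. -/
theorem susEvent_shift (Φ : Flow σ N) (φ ψ : ℕ → T3 → ℝ) (Δ a ε lam Cw t' : ℝ) {z : Cfg N}
    (hz : z ∈ Φ.good) :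
    z ∈ susEvent σ N Φ φ ψ Δ a ε lam Cw t' ↔
      Φ.flow (t' - Δ) z ∈ susEvent σ N Φ φ ψ Δ a ε lam Cw Δ := by
  have hzs : Φ.flow (t' - Δ) z ∈ Φ.good := Φ.mapsTo_good (t' - Δ) hz
  simp only [susEvent, mem_setOf_eq]
  rw [winA_flow Φ φ ψ Δ (t' - Δ) hz, winTail_flow Φ lam Δ (t' - Δ) hz, sub_self, Φ.flow_zero _ hzs,
    add_sub_cancel]

/-- Set form: `susEvent(t') ∩ good = Φ_{t'−Δ}⁻¹(susEvent(Δ)) ∩ good`. -/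
theorem susEvent_inter_good_eq (Φ : Flow σ N) (φ ψ : ℕ → T3 → ℝ) (Δ a ε lam Cw t' : ℝ) :
    susEvent σ N Φ φ ψ Δ a ε lam Cw t' ∩ Φ.good =
      Φ.flow (t' - Δ) ⁻¹' susEvent σ N Φ φ ψ Δ a ε lam Cw Δ ∩ Φ.good := by
  ext z
  simp only [mem_inter_iff, mem_preimage]
  constructor
  · rintro ⟨h, hz⟩
    exact ⟨(susEvent_shift Φ φ ψ Δ a ε lam Cw t' hz).1 h, hz⟩
  · rintro ⟨h, hz⟩
    exact ⟨(susEvent_shift Φ φ ψ Δ a ε lam Cw t' hz).2 h, hz⟩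

/-- Under a law for which the good set is conull, an event has the measure of its trace on the good set. -/
theorem measure_eq_measure_inter_good (Φ : Flow σ N) (μ : Measure (Cfg N)) (hμ : ∀ᵐ z ∂μ, z ∈ Φ.good)
    (A : Set (Cfg N)) : μ A = μ (A ∩ Φ.good) := by
  refine le_antisymm ?_ (measure_mono inter_subset_left)
  have h0 : μ (Φ.goodᶜ) = 0 := ae_iff.1 hμ
  calc μ A ≤ μ (A ∩ Φ.good ∪ Φ.goodᶜ) := measure_mono fun z hz => by
        by_cases h : z ∈ Φ.good
        · exact Or.inl ⟨hz, h⟩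
        · exact Or.inr h
    _ ≤ μ (A ∩ Φ.good) + μ (Φ.goodᶜ) := measure_union_le _ _
    _ = μ (A ∩ Φ.good) := by rw [h0, add_zero]

/-- **Uniformity in the window end is free under the homogeneous Gibbs law.** For constant profiles `(a₁, u₁, θ₁)` (in
particular the line's `G_N = localGibbsLaw σ 1 0 θe`), every flow, every window length `Δ` and every window end `t'`:
`G_N(susEvent(t')) ≤ G_N(susEvent(Δ))` — the good set is `G_N`-conull, on it `susEvent(t')` is the `Φ_{t'−Δ}`-preimage of
`susEvent(Δ)`, and `Φ_{t'−Δ}` preserves `G_N` (`measurePreserving_flow_localGibbsLaw_const`). -/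
theorem gibbs_susEvent_le (a₁ θ₁ : ℝ) (u₁ : V3) (Φ : Flow σ N) (φ ψ : ℕ → T3 → ℝ)
    (Δ a ε lam Cw t' : ℝ) :
    localGibbsLaw σ (fun _ => a₁) (fun _ => u₁) (fun _ => θ₁) N Φ (susEvent σ N Φ φ ψ Δ a ε lam Cw t') ≤
      localGibbsLaw σ (fun _ => a₁) (fun _ => u₁) (fun _ => θ₁) N Φ (susEvent σ N Φ φ ψ Δ a ε lam Cw Δ) := by
  set μ := localGibbsLaw σ (fun _ => a₁) (fun _ => u₁) (fun _ => θ₁) N Φ with hμ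
  have hae : ∀ᵐ z ∂μ, z ∈ Φ.good := ae_mem_good_localGibbsLaw σ _ _ _ N Φ
  have hmp : MeasurePreserving (Φ.flow (t' - Δ)) μ μ :=
    measurePreserving_flow_localGibbsLaw_const σ a₁ θ₁ u₁ N Φ (t' - Δ)
  calc μ (susEvent σ N Φ φ ψ Δ a ε lam Cw t')
      = μ (susEvent σ N Φ φ ψ Δ a ε lam Cw t' ∩ Φ.good) := measure_eq_measure_inter_good Φ μ hae _
    _ = μ (Φ.flow (t' - Δ) ⁻¹' susEvent σ N Φ φ ψ Δ a ε lam Cw Δ ∩ Φ.good) := by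
        rw [susEvent_inter_good_eq]
    _ ≤ μ (Φ.flow (t' - Δ) ⁻¹' susEvent σ N Φ φ ψ Δ a ε lam Cw Δ) := measure_mono inter_subset_left
    _ ≤ μ.map (Φ.flow (t' - Δ)) (susEvent σ N Φ φ ψ Δ a ε lam Cw Δ) :=
        Measure.le_map_apply hmp.measurable.aemeasurable _
    _ = μ (susEvent σ N Φ φ ψ Δ a ε lam Cw Δ) := by rw [hmp.map_eq]

/-- **Reduction of the `∀ t' ≥ Δ_N` clause of `stub_superExp` to the window `[0, Δ_N]`.** If the homogeneous-Gibbs bound holds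
eventually in `N` at the window end `t' = Δ N`, it holds eventually in `N` for all window ends `t' ≥ Δ N` (indeed for all `t'`). -/
theorem forall_windowEnd_of_windowStart {θe : ℝ} {Φ : Flows σ} {φ ψ : ℕ → T3 → ℝ} {Δ : ℕ → ℝ}
    {a ε lam Cw : ℝ} {b : ℕ → ℝ≥0∞}
    (h : ∀ᶠ N : ℕ in atTop,
      localGibbsLaw σ (fun _ => 1) (fun _ => 0) (fun _ => θe) N (Φ N)
        (susEvent σ N (Φ N) φ ψ (Δ N) a ε lam Cw (Δ N)) ≤ b N) :
    ∀ᶠ N : ℕ in atTop, ∀ t' : ℝ, Δ N ≤ t' →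
      localGibbsLaw σ (fun _ => 1) (fun _ => 0) (fun _ => θe) N (Φ N)
        (susEvent σ N (Φ N) φ ψ (Δ N) a ε lam Cw t') ≤ b N := by
  filter_upwards [h] with N hN t' _
  exact (gibbs_susEvent_le 1 θe 0 (Φ N) φ ψ (Δ N) a ε lam Cw t').trans hN

end SuperExp

/-- Registered anchor of this helper file (`gibbs_susEvent_le` for the line's homogeneous law `G_N = localGibbsLaw σ 1 0 θe`):
uniformity of the `stub_superExp` bound in the window end is free. -/
theorem superExp_invariance_anchor : ∀ (σ θe : ℝ) (N : ℕ) (Φ : Flow σ N) (φ ψ : ℕ → T3 → ℝ)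
    (Δ a ε lam Cw t' : ℝ),
    localGibbsLaw σ (fun _ => 1) (fun _ => 0) (fun _ => θe) N Φ (susEvent σ N Φ φ ψ Δ a ε lam Cw t') ≤
      localGibbsLaw σ (fun _ => 1) (fun _ => 0) (fun _ => θe) N Φ (susEvent σ N Φ φ ψ Δ a ε lam Cw Δ) :=
  fun _ θe _ Φ φ ψ Δ a ε lam Cw t' => SuperExp.gibbs_susEvent_le 1 θe 0 Φ φ ψ Δ a ε lam Cw t'

end

end Summit.AtomisticToContinuum.HydrodynamicLimit.Theorems.SustainedAnisotropy
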